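import Summits.BirchSwinnertonDyer.BirchSwinnertonDyer.Theorems.BiquadraticEisensteinDescentHeegnerTwistCouplingInSupplySymbolicMonskyPatternFreeDoor
import Summits.BirchSwinnertonDyer.BirchSwinnertonDyer.Theorems.BiquadraticEisensteinDescentHeegnerTwistCouplingInSupplyLinnikCensusKOneThree
import HarnessLib

set_option linter.dupNamespace false -- `Summit.BirchSwinnertonDyer.BirchSwinnertonDyer.Theorems.…` (summit = sub)
set_option autoImplicit false

/-!
# Crux `HeegnerTwistCouplingInSupply` (stmt-BirchSwinnertonDyer-21381) — the PATTERN-FREE LINNIK CENSUS AT GENERAL `k`: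
# bases `E_{p·r₁⋯r_k}` / `E_{2p·r₁⋯r_k}`, at most three slots, modulo Burungale–Tian only

Route `BiquadraticEisensteinDescent` (cell `pub/bsd-wall`, width seat `bsd-wall-cm-bed-w3` g20; `--supports` 21381, helper). This is
w3 g19's `…LinnikCensusKOne` / `…KOneThree` (k = 1) rewritten ONCE for every `k`: the winning-for-every-pattern hypothesis `hwin`
(one `decide` over all `2^(t(t−1)/2)` mutual patterns) is replaced by the pattern-free CRITERION `pfRecipeOdd/Even base aux` (ONE
`decide`, no mutual symbol; `…SymbolicMonskyPatternFree*`), and the door is the general-`k` door `RealisesK.cruxOn_odd/even_of_BT`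
(`…PatternFreeDoor`). Supply: one `slotCensus` per slot (Montgomery's large sieve + PNT-AP, tree, PROVED), slot classes modulo
`M = 8·∏ r_j`; distinct cells ⇒ distinct primes; size `√∏q·log∏q < πp` from `∏q ≤ y³`, `y = ⌊⌊√Q⌋^{1/2}⌋ ≥ 256` (`t ≤ 3`).

* `size_of_le_cube`, `prod_le_cube`, `mod_eight_of_slot`, `ne_of_slot_of_dvd` — bookkeeping;
* ★★ `kAny_allBut_odd_of_BT` / `kAny_allBut_even_of_BT` — for base data `base : SymbData (k+1)`, cells `aux` (`pfRecipe…`, pairwise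
  distinct, `t ≤ 3`), actual base primes `r_j` realising the tail of `base`, unit slot classes `κ_i (mod 8∏r_j)` matching the cells:
  `∃ C > 0, ∀ Q ≥ 3, ∃ E, #E ≤ C (log Q)⁸`, every prime `p` of the base's `p`-class (`p mod 8`, the symbols `(r_j/p)`) with
  `⌊√Q⌋ < p ≤ Q`, `p ∉ E` has the conclusion of crux 21381 for `W = E_{p∏r}` / `E_{2p∏r}`, modulo Burungale–Tian ONLY;
* (the `k = 2` two-slot specialisation with scalar parameters and the first instances `E_{15p}`, `E_{21p}` are in
  `…LinnikCensusKTwo`.)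

HONEST FRAMING: RUNG-LEVEL corner layer; per FIXED `r₁, …, r_k` (no uniformity in the `r_j`), density one in `p` with a polylog
exceptional set (every individual `p` conceded); congruent `j = 1728` full-2-torsion families only; `t ≤ 3` slots (larger `t` needs
the located height `Q^{1/5}`); which configurations OWN a pattern-free family is decided per instance (memo PATTERN-FREE-MECHANISM-w3g20:
`t = s*/2 + 1` generically). The crux as stated (C⁺), its registered stubs and BSD are NOT touched; nothing is closed. THEOREMS ONLY.
-/

namespace Summit.BirchSwinnertonDyer.BirchSwinnertonDyer.Theorems.LinnikCensus

open Finset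
open Literature.NumberTheory.EllipticCurves
open Summit.BirchSwinnertonDyer.BirchSwinnertonDyer.Theorems.SymbolicMonsky

/-! ## Size for at most three slots -/

/-- **Size**: `1 ≤ m ≤ y³`, `256 ≤ y`, `y² < p` ⇒ `√m·log m < πp`. [folklore] -/
theorem size_of_le_cube {m y p : ℕ} (h1 : 1 ≤ m) (hm : m ≤ y ^ 3) (hy : 256 ≤ y) (hp : y ^ 2 < p) :
    Real.sqrt (m : ℝ) * Real.log (m : ℝ) < Real.pi * p := by
  have hy' : (256 : ℝ) ≤ y := by exact_mod_cast hy
  have hy0 : (0 : ℝ) < y := by linarith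
  have hm1 : (1 : ℝ) ≤ (m : ℝ) := by exact_mod_cast h1
  have hmy : (m : ℝ) ≤ (y : ℝ) ^ 3 := by exact_mod_cast hm
  have hsqrt : Real.sqrt (m : ℝ) ≤ y * Real.sqrt y := by
    calc Real.sqrt (m : ℝ) ≤ Real.sqrt ((y : ℝ) ^ 3) := Real.sqrt_le_sqrt hmy
      _ = Real.sqrt ((y : ℝ) ^ 2 * y) := by ring_nf
      _ = y * Real.sqrt y := by rw [Real.sqrt_mul (by positivity), Real.sqrt_sq hy0.le]
  have hlog : Real.log (m : ℝ) ≤ 3 * Real.log y := by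
    calc Real.log (m : ℝ) ≤ Real.log ((y : ℝ) ^ 3) := Real.log_le_log (by positivity) hmy
      _ = 3 * Real.log y := by rw [Real.log_pow]; norm_num
  have hlog0 : 0 ≤ Real.log (m : ℝ) := Real.log_nonneg hm1
  have hkey := three_mul_log_lt_pi_mul_sqrt hy'
  have hp' : (y : ℝ) ^ 2 < p := by exact_mod_cast hp
  have hsy : Real.sqrt y * Real.sqrt y = y := Real.mul_self_sqrt hy0.le
  calc Real.sqrt (m : ℝ) * Real.log (m : ℝ)
      ≤ (y * Real.sqrt y) * (3 * Real.log y) := mul_le_mul hsqrt hlog hlog0 (by positivity)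
    _ < (y * Real.sqrt y) * (Real.pi * Real.sqrt y) := by
        apply mul_lt_mul_of_pos_left hkey; positivity
    _ = Real.pi * (y : ℝ) ^ 2 := by
        calc (y * Real.sqrt y) * (Real.pi * Real.sqrt y) = Real.pi * y * (Real.sqrt y * Real.sqrt y) := by ring
          _ = Real.pi * (y : ℝ) ^ 2 := by rw [hsy]; ring
    _ < Real.pi * p := by gcongr

/-- A product of at most three factors `≤ y` (and `≥ 1`) is `≤ y³`. [folklore] -/
theorem prod_le_cube {t : ℕ} (ht : t ≤ 3) {y : ℕ} (hy : 1 ≤ y) (q : Fin t → ℕ) (hq : ∀ i, q i ≤ y) :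
    ∏ i, q i ≤ y ^ 3 := by
  calc ∏ i, q i ≤ ∏ _i : Fin t, y := Finset.prod_le_prod' fun i _ => hq i
    _ = y ^ t := by simp
    _ ≤ y ^ 3 := Nat.pow_le_pow_right hy ht

/-! ## Slot properties modulo `M = 8·∏ r` -/

/-- A prime `q` in a unit class `κ (mod M)` with `κ ≡ a (mod 8)` and `8 ∣ M` has `q ≡ a (mod 8)`. [folklore] -/
theorem mod_eight_of_slot {M κ q a : ℕ} (h8 : 8 ∣ M) (hqk : q % M = κ % M) (hka : κ % 8 = a) : q % 8 = a := by
  rw [← Nat.mod_mod_of_dvd q h8, hqk, Nat.mod_mod_of_dvd κ h8, hka]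

/-- A number in a unit class modulo `M` is not a prime divisor `r > 1` of `M`. [folklore] -/
theorem ne_of_slot_of_dvd {M κ q r : ℕ} [NeZero M] (hku : IsUnit ((κ : ℕ) : ZMod M)) (hqk : q % M = κ % M)
    (hr : 1 < r) (hrM : r ∣ M) : q ≠ r := by
  rintro rfl
  have hqk' : ((q : ℕ) : ZMod M) = ((κ : ℕ) : ZMod M) := (ZMod.natCast_eq_natCast_iff' q κ M).mpr hqk
  rw [← hqk', ZMod.isUnit_iff_coprime] at hku
  have : Nat.Coprime q q := Nat.Coprime.coprime_dvd_right hrM hku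
  rw [Nat.coprime_self] at this
  omega

/-! ## The general-`k` census (at most three slots), odd base `W = E_{p·r₁⋯r_k}` -/

open scoped Classical in
/-- ★★ **General-`k` PATTERN-FREE CENSUS, odd base `W = E_{p·r₁⋯r_k}` (at most three slots).** Fix base symbol data `base` (index `0`
= `p`, index `j+1` = `r_j`) and auxiliary cells `aux` with `pfRecipeOdd base aux = true` (ONE `decide`: Heegner check + the
pattern-free criterion of `…SymbolicMonskyPatternFree*`), pairwise distinct cells (`hdist`, decidable), actual base primes `r_j`
realising the tail of `base` (`hrm`, `hrr`), and unit slot classes `κ_i (mod M)`, `M = 8·∏ r_j`, matching the cells (`hκm`: class mod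
`8`; `hκe`: primes `q ≡ κ_i` have the cell's symbols `(q/r_j)`). Then, modulo Burungale–Tian ONLY: `∃ C > 0, ∀ Q ≥ 3, ∃ E, #E ≤ C (log Q)⁸`,
and every prime `p` in the base's `p`-class (`p ≡ base.cls 0 (mod 8)`, `[(r_j/p) = −1] = base.up 0 (j+1)`) with `⌊√Q⌋ < p ≤ Q`,
`p ∉ E` has the conclusion of crux 21381 for `W = E_{p·∏r_j}`: a Heegner field `K′` of `N(W)` with `4 < |d_{K′}|`,
`L(W^{(d_{K′})}, 1) ≠ 0`, `p ∤ h(K′)`. NOTHING is asked of the mutual symbols `(q_j/q_i)` of the slot primes (criterion), so the supply is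
`t` independent slot censuses (`slotCensus`: Montgomery's large sieve + PNT-AP, tree, proved). `k = 1` is `kOne_allBut_two/three_of_BT`.
[cite: BurungaleTian2026, Thm. 1.1] [cite: Montgomery1978, p. 561] [cite: MontgomeryVaughan2007, Cor. 11.17] -/
theorem kAny_allBut_odd_of_BT (hBT : burungaleTian_analyticRank_eq_zero_of_selmerCorank_eq_zero_of_hasCM)
    {k : ℕ} (base : SymbData (k + 1)) (aux : List AuxCell) (hpf : pfRecipeOdd base aux = true) (ht : aux.length ≤ 3)
    (hdist : ∀ i j : Fin aux.length, i ≠ j → (aux.getD i.val (0, 0)).1 ≠ (aux.getD j.val (0, 0)).1 ∨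
      ∃ b : Fin (k + 1), (aux.getD i.val (0, 0)).2.testBit b.val ≠ (aux.getD j.val (0, 0)).2.testBit b.val)
    (r : Fin k → ℕ) (hr : ∀ j, (r j).Prime) (hrm : ∀ j, r j % 8 = clsVal (base.cls j.succ))
    (hrinj : Function.Injective r)
    (hrr : ∀ i j : Fin k, i < j → (jacobiSym (r j : ℤ) (r i) = -1 ↔ base.up i.succ j.succ = true))
    {M : ℕ} (hM : M = 8 * ∏ j, r j) (κ : Fin aux.length → ℕ) (hκu : ∀ i, IsUnit ((κ i : ℕ) : ZMod M))
    (hκm : ∀ i, κ i % 8 = clsVal (aux.getD i.val (0, 0)).1)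
    (hκe : ∀ i (q : ℕ), q.Prime → q % M = κ i % M →
      ∀ j : Fin k, jacobiSym (q : ℤ) (r j) = -1 ↔ (aux.getD i.val (0, 0)).2.testBit j.succ.val = true) :
    ∃ C : ℝ, 0 < C ∧ ∀ Q : ℕ, 3 ≤ Q → ∃ E : Finset ℕ, (E.card : ℝ) ≤ C * Real.log Q ^ 8 ∧
      ∀ p : ℕ, p.Prime → p % 8 = clsVal (base.cls 0) →
        (∀ j : Fin k, jacobiSym (r j : ℤ) p = -1 ↔ base.up 0 j.succ = true) →
        Nat.sqrt Q < p → p ≤ Q → p ∉ E →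
        ∃ (K : Type) (_ : Field K) (_ : NumberField K),
          IsImaginaryQuadratic K ∧ 4 < (NumberField.discr K).natAbs ∧
          SatisfiesHeegnerHypothesis ((congruentNumberCurve (p * ∏ j, r j)).conductorNorm ℤ) K ∧
          ((congruentNumberCurve (p * ∏ j, r j)).quadraticTwist (NumberField.discr K : ℚ)).entireLFunction 1 ≠ 0 ∧
          ¬ p ∣ NumberField.classNumber K := by
  have hMpos : M ≠ 0 := by rw [hM]; exact Nat.mul_ne_zero (by norm_num) (Finset.prod_ne_zero_iff.mpr fun j _ => (hr j).ne_zero)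
  haveI : NeZero M := ⟨hMpos⟩
  have h8M : 8 ∣ M := by rw [hM]; exact dvd_mul_right 8 _
  have hrM : ∀ j, r j ∣ M := fun j => by rw [hM]; exact Dvd.dvd.mul_left (Finset.dvd_prod_of_mem r (Finset.mem_univ j)) 8
  -- the slot signs `(q/p)`
  set sg : Fin aux.length → ℤ := fun i => if (aux.getD i.val (0, 0)).2.testBit 0 then -1 else 1 with hsg
  have hσ : ∀ i, sg i = 1 ∨ sg i = -1 := fun i => by
    simp only [hsg]; split_ifs <;> simp
  -- one census per slot
  have hcen : ∀ i, ∃ C : ℝ, 0 < C ∧ ∀ Q : ℕ, 3 ≤ Q →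
      ((((Finset.range (Q + 1)).filter (fun p : ℕ => p.Prime ∧ Nat.sqrt Q < p ∧
          ∀ q : ℕ, q.Prime → q % M = κ i % M → q ≤ Nat.sqrt (Nat.sqrt Q) → jacobiSym (q : ℤ) p ≠ sg i)).card : ℝ))
        ≤ C * Real.log Q ^ 8 := fun i => slotCensus M (κ i) (hκu i) (hσ i)
  choose C hC hcenQ using hcen
  -- threshold `T`: every `r_j ≤ √Q` and `⌊⌊√Q⌋^{1/2}⌋ ≥ 256`
  set T : ℕ := (∑ j, r j ^ 2) + 256 ^ 4 with hT
  have hCnn : 0 ≤ ∑ i, C i := Finset.sum_nonneg fun i _ => (hC i).le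
  refine ⟨(∑ i, C i) + ((T : ℝ) + 1), add_pos_of_nonneg_of_pos hCnn (by positivity), fun Q hQ3 => ?_⟩
  have hlog3 : 1 ≤ Real.log Q := by
    have hQ3' : (3 : ℝ) ≤ Q := by exact_mod_cast hQ3
    have he : Real.exp 1 ≤ (Q : ℝ) := le_trans (le_of_lt (lt_trans Real.exp_one_lt_d9 (by norm_num))) hQ3'
    rwa [← Real.log_le_log_iff (Real.exp_pos 1) (by linarith), Real.log_exp] at he
  have hlog8 : 1 ≤ Real.log Q ^ 8 := one_le_pow₀ hlog3
  have hTl : 0 ≤ ((T : ℝ) + 1) * Real.log Q ^ 8 := by positivity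
  by_cases hQT : T ≤ Q
  · -- the exceptional set: union of the slot exceptional sets
    set Ei : Fin aux.length → Finset ℕ := fun i => (Finset.range (Q + 1)).filter (fun p : ℕ => p.Prime ∧ Nat.sqrt Q < p ∧
        ∀ q : ℕ, q.Prime → q % M = κ i % M → q ≤ Nat.sqrt (Nat.sqrt Q) → jacobiSym (q : ℤ) p ≠ sg i) with hEi
    refine ⟨Finset.univ.biUnion Ei, ?_, ?_⟩
    · calc ((Finset.univ.biUnion Ei).card : ℝ) ≤ ∑ i, ((Ei i).card : ℝ) := by
            exact_mod_cast Finset.card_biUnion_le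
        _ ≤ ∑ i, C i * Real.log Q ^ 8 := Finset.sum_le_sum fun i _ => hcenQ i Q hQ3
        _ = (∑ i, C i) * Real.log Q ^ 8 := by rw [Finset.sum_mul]
        _ ≤ ((∑ i, C i) + ((T : ℝ) + 1)) * Real.log Q ^ 8 := by rw [add_mul]; linarith
    intro p hp hpm hrp hyp hpQ hpE
    have hpE' : ∀ i, p ∉ Ei i := fun i hi => hpE (Finset.mem_biUnion.mpr ⟨i, Finset.mem_univ i, hi⟩)
    -- one located prime per slot
    have hslot : ∀ i, ∃ q : ℕ, q.Prime ∧ q % M = κ i % M ∧ q ≤ Nat.sqrt (Nat.sqrt Q) ∧ jacobiSym (q : ℤ) p = sg i :=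
      fun i => exists_slotPrime hp hyp hpQ (hpE' i)
    choose q hq hqκ hqy hqJ using hslot
    -- elementary facts about `y = ⌊⌊√Q⌋^{1/2}⌋`, `p`, `r_j`, `q_i`
    have hyQ : Nat.sqrt (Nat.sqrt Q) ≤ Nat.sqrt Q := Nat.sqrt_le_self _
    have hy256 : 256 ≤ Nat.sqrt (Nat.sqrt Q) := by
      rw [Nat.le_sqrt', Nat.le_sqrt']
      exact le_trans (by norm_num) (le_trans (Nat.le_add_left _ _) hQT)
    have hrQ : ∀ j, r j ≤ Nat.sqrt Q := fun j => Nat.le_sqrt'.mpr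
      (le_trans (Finset.single_le_sum (f := fun j => r j ^ 2) (fun j _ => Nat.zero_le _) (Finset.mem_univ j))
        (le_trans (Nat.le_add_right _ _) hQT))
    have hpr : ∀ j, p ≠ r j := fun j h => by have := hrQ j; omega
    have hqp : ∀ i, q i ≠ p := fun i h => by have := hqy i; omega
    have hqm : ∀ i, q i % 8 = clsVal (aux.getD i.val (0, 0)).1 := fun i => mod_eight_of_slot h8M (hqκ i) (hκm i)
    have hqr : ∀ i j, q i ≠ r j := fun i j => ne_of_slot_of_dvd (hκu i) (hqκ i) (hr j).one_lt (hrM j)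
    have hqe : ∀ i (j : Fin k), jacobiSym (q i : ℤ) (r j) = -1 ↔ (aux.getD i.val (0, 0)).2.testBit j.succ.val = true :=
      fun i j => hκe i (q i) (hq i) (hqκ i) j
    have hq0 : ∀ i, jacobiSym (q i : ℤ) p = -1 ↔ (aux.getD i.val (0, 0)).2.testBit 0 = true := fun i =>
      sign_iff_of_eq (by rw [hqJ i])
    -- the base primes realise the base datum
    have hbase : Matches (Fin.cons p r : Fin (k + 1) → ℕ) base := by
      refine ⟨fun i => Fin.cases (by simpa using hp) (fun j => by simpa using hr j) i, ?_, ?_, ?_⟩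
      · rw [Fin.cons_injective_iff]
        refine ⟨?_, hrinj⟩
        rintro ⟨j, hj⟩; exact hpr j hj.symm
      · intro i
        refine Fin.cases ?_ (fun j => ?_) i
        · simpa using hpm
        · simpa using hrm j
      · intro i j hij
        revert hij
        refine Fin.cases ?_ (fun i' => ?_) i <;> refine Fin.cases ?_ (fun j' => ?_) j
        · intro hij; exact absurd hij (lt_irrefl _)
        · intro _; simpa using hrp j'
        · intro hij; exact absurd hij (Fin.not_lt_zero _)
        · intro hij; simpa using hrr i' j' (Fin.succ_lt_succ_iff.mp hij)
    -- the realisation (NO mutual-symbol condition)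
    have hR : RealisesK base aux (Fin.cons p r) q := by
      refine ⟨hbase, hq, hqm, fun i b => ?_, ?_, fun i b => ?_⟩
      · refine Fin.cases ?_ (fun j => ?_) b
        · simpa using hqp i
        · simpa using hqr i j
      · intro i i' hii'
        by_contra hne
        rcases hdist i i' hne with hcls | ⟨b, hb⟩
        · exact hcls (clsVal_injective ((hqm i).symm.trans (by rw [hii']; exact hqm i')))
        · apply hb
          revert b
          refine Fin.cases ?_ (fun j => ?_)
          · intro hb
            have a := hq0 i; have a' := hq0 i'
            rw [hii'] at a
            exact Bool.eq_iff_iff.mpr (a.symm.trans a')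
          · intro hb
            have a := hqe i j; have a' := hqe i' j
            rw [hii'] at a
            exact Bool.eq_iff_iff.mpr (a.symm.trans a')
      · refine Fin.cases ?_ (fun j => ?_) b
        · simpa using hq0 i
        · simpa using hqe i j
    -- size and the door
    have hysq : Nat.sqrt (Nat.sqrt Q) ^ 2 ≤ Nat.sqrt Q := Nat.sqrt_le' _
    have hprod1 : 1 ≤ ∏ i, q i := Nat.one_le_iff_ne_zero.mpr (Finset.prod_ne_zero_iff.mpr fun i _ => (hq i).ne_zero)
    have hsize := size_of_le_cube hprod1 (prod_le_cube ht (by omega) q hqy) hy256 (lt_of_le_of_lt hysq hyp)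
    have hn : ∏ b, (Fin.cons p r : Fin (k + 1) → ℕ) b = p * ∏ j, r j := by
      rw [Fin.prod_univ_succ]; simp
    haveI : (congruentNumberCurve (p * ∏ j, r j)).IsElliptic := by
      refine isElliptic_congruentNumberCurve (Nat.mul_ne_zero hp.ne_zero
        (Finset.prod_ne_zero_iff.mpr fun j _ => (hr j).ne_zero))
    have hsize' : Real.sqrt ((∏ i, q i : ℕ) : ℝ) * Real.log ((∏ i, q i : ℕ) : ℝ) <
        Real.pi * (Fin.cons p r : Fin (k + 1) → ℕ) 0 := by simpa using hsize
    simpa using hR.cruxOn_odd_of_BT hBT hpf hn hsize'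
  · -- `Q < T`: everything is exceptional
    refine ⟨Finset.range (Q + 1), ?_, fun p _ _ _ _ hpQ hpE => absurd (Finset.mem_range.mpr (by omega)) hpE⟩
    have hQ' : Q < T := not_le.mp hQT
    have h1 : ((Finset.range (Q + 1)).card : ℝ) ≤ (T : ℝ) + 1 := by
      rw [Finset.card_range]; exact_mod_cast (by omega : Q + 1 ≤ T + 1)
    calc ((Finset.range (Q + 1)).card : ℝ) ≤ (T : ℝ) + 1 := h1
      _ ≤ (∑ i, C i) + ((T : ℝ) + 1) := by linarith
      _ = ((∑ i, C i) + ((T : ℝ) + 1)) * 1 := (mul_one _).symm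
      _ ≤ ((∑ i, C i) + ((T : ℝ) + 1)) * Real.log Q ^ 8 :=
          mul_le_mul_of_nonneg_left hlog8 (add_nonneg hCnn (by positivity))

/-! ## The general-`k` census (at most three slots), even base `W = E_{2p·r₁⋯r_k}` -/

open scoped Classical in
/-- ★★ **General-`k` PATTERN-FREE CENSUS, even base `W = E_{2p·r₁⋯r_k}` (at most three slots).** Same as `kAny_allBut_odd_of_BT`
with `pfRecipeEven` and `W = E_{2p·∏r_j}`. [cite: BurungaleTian2026, Thm. 1.1] [cite: Montgomery1978, p. 561] [cite: MontgomeryVaughan2007, Cor. 11.17] -/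
theorem kAny_allBut_even_of_BT (hBT : burungaleTian_analyticRank_eq_zero_of_selmerCorank_eq_zero_of_hasCM)
    {k : ℕ} (base : SymbData (k + 1)) (aux : List AuxCell) (hpf : pfRecipeEven base aux = true) (ht : aux.length ≤ 3)
    (hdist : ∀ i j : Fin aux.length, i ≠ j → (aux.getD i.val (0, 0)).1 ≠ (aux.getD j.val (0, 0)).1 ∨
      ∃ b : Fin (k + 1), (aux.getD i.val (0, 0)).2.testBit b.val ≠ (aux.getD j.val (0, 0)).2.testBit b.val)
    (r : Fin k → ℕ) (hr : ∀ j, (r j).Prime) (hrm : ∀ j, r j % 8 = clsVal (base.cls j.succ))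
    (hrinj : Function.Injective r)
    (hrr : ∀ i j : Fin k, i < j → (jacobiSym (r j : ℤ) (r i) = -1 ↔ base.up i.succ j.succ = true))
    {M : ℕ} (hM : M = 8 * ∏ j, r j) (κ : Fin aux.length → ℕ) (hκu : ∀ i, IsUnit ((κ i : ℕ) : ZMod M))
    (hκm : ∀ i, κ i % 8 = clsVal (aux.getD i.val (0, 0)).1)
    (hκe : ∀ i (q : ℕ), q.Prime → q % M = κ i % M →
      ∀ j : Fin k, jacobiSym (q : ℤ) (r j) = -1 ↔ (aux.getD i.val (0, 0)).2.testBit j.succ.val = true) :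
    ∃ C : ℝ, 0 < C ∧ ∀ Q : ℕ, 3 ≤ Q → ∃ E : Finset ℕ, (E.card : ℝ) ≤ C * Real.log Q ^ 8 ∧
      ∀ p : ℕ, p.Prime → p % 8 = clsVal (base.cls 0) →
        (∀ j : Fin k, jacobiSym (r j : ℤ) p = -1 ↔ base.up 0 j.succ = true) →
        Nat.sqrt Q < p → p ≤ Q → p ∉ E →
        ∃ (K : Type) (_ : Field K) (_ : NumberField K),
          IsImaginaryQuadratic K ∧ 4 < (NumberField.discr K).natAbs ∧
          SatisfiesHeegnerHypothesis ((congruentNumberCurve (2 * (p * ∏ j, r j))).conductorNorm ℤ) K ∧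
          ((congruentNumberCurve (2 * (p * ∏ j, r j))).quadraticTwist (NumberField.discr K : ℚ)).entireLFunction 1 ≠ 0 ∧
          ¬ p ∣ NumberField.classNumber K := by
  have hMpos : M ≠ 0 := by rw [hM]; exact Nat.mul_ne_zero (by norm_num) (Finset.prod_ne_zero_iff.mpr fun j _ => (hr j).ne_zero)
  haveI : NeZero M := ⟨hMpos⟩
  have h8M : 8 ∣ M := by rw [hM]; exact dvd_mul_right 8 _
  have hrM : ∀ j, r j ∣ M := fun j => by rw [hM]; exact Dvd.dvd.mul_left (Finset.dvd_prod_of_mem r (Finset.mem_univ j)) 8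
  -- the slot signs `(q/p)`
  set sg : Fin aux.length → ℤ := fun i => if (aux.getD i.val (0, 0)).2.testBit 0 then -1 else 1 with hsg
  have hσ : ∀ i, sg i = 1 ∨ sg i = -1 := fun i => by
    simp only [hsg]; split_ifs <;> simp
  -- one census per slot
  have hcen : ∀ i, ∃ C : ℝ, 0 < C ∧ ∀ Q : ℕ, 3 ≤ Q →
      ((((Finset.range (Q + 1)).filter (fun p : ℕ => p.Prime ∧ Nat.sqrt Q < p ∧
          ∀ q : ℕ, q.Prime → q % M = κ i % M → q ≤ Nat.sqrt (Nat.sqrt Q) → jacobiSym (q : ℤ) p ≠ sg i)).card : ℝ))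
        ≤ C * Real.log Q ^ 8 := fun i => slotCensus M (κ i) (hκu i) (hσ i)
  choose C hC hcenQ using hcen
  -- threshold `T`: every `r_j ≤ √Q` and `⌊⌊√Q⌋^{1/2}⌋ ≥ 256`
  set T : ℕ := (∑ j, r j ^ 2) + 256 ^ 4 with hT
  have hCnn : 0 ≤ ∑ i, C i := Finset.sum_nonneg fun i _ => (hC i).le
  refine ⟨(∑ i, C i) + ((T : ℝ) + 1), add_pos_of_nonneg_of_pos hCnn (by positivity), fun Q hQ3 => ?_⟩
  have hlog3 : 1 ≤ Real.log Q := by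
    have hQ3' : (3 : ℝ) ≤ Q := by exact_mod_cast hQ3
    have he : Real.exp 1 ≤ (Q : ℝ) := le_trans (le_of_lt (lt_trans Real.exp_one_lt_d9 (by norm_num))) hQ3'
    rwa [← Real.log_le_log_iff (Real.exp_pos 1) (by linarith), Real.log_exp] at he
  have hlog8 : 1 ≤ Real.log Q ^ 8 := one_le_pow₀ hlog3
  have hTl : 0 ≤ ((T : ℝ) + 1) * Real.log Q ^ 8 := by positivity
  by_cases hQT : T ≤ Q
  · -- the exceptional set: union of the slot exceptional sets
    set Ei : Fin aux.length → Finset ℕ := fun i => (Finset.range (Q + 1)).filter (fun p : ℕ => p.Prime ∧ Nat.sqrt Q < p ∧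
        ∀ q : ℕ, q.Prime → q % M = κ i % M → q ≤ Nat.sqrt (Nat.sqrt Q) → jacobiSym (q : ℤ) p ≠ sg i) with hEi
    refine ⟨Finset.univ.biUnion Ei, ?_, ?_⟩
    · calc ((Finset.univ.biUnion Ei).card : ℝ) ≤ ∑ i, ((Ei i).card : ℝ) := by
            exact_mod_cast Finset.card_biUnion_le
        _ ≤ ∑ i, C i * Real.log Q ^ 8 := Finset.sum_le_sum fun i _ => hcenQ i Q hQ3
        _ = (∑ i, C i) * Real.log Q ^ 8 := by rw [Finset.sum_mul]
        _ ≤ ((∑ i, C i) + ((T : ℝ) + 1)) * Real.log Q ^ 8 := by rw [add_mul]; linarith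
    intro p hp hpm hrp hyp hpQ hpE
    have hpE' : ∀ i, p ∉ Ei i := fun i hi => hpE (Finset.mem_biUnion.mpr ⟨i, Finset.mem_univ i, hi⟩)
    -- one located prime per slot
    have hslot : ∀ i, ∃ q : ℕ, q.Prime ∧ q % M = κ i % M ∧ q ≤ Nat.sqrt (Nat.sqrt Q) ∧ jacobiSym (q : ℤ) p = sg i :=
      fun i => exists_slotPrime hp hyp hpQ (hpE' i)
    choose q hq hqκ hqy hqJ using hslot
    -- elementary facts about `y = ⌊⌊√Q⌋^{1/2}⌋`, `p`, `r_j`, `q_i`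
    have hyQ : Nat.sqrt (Nat.sqrt Q) ≤ Nat.sqrt Q := Nat.sqrt_le_self _
    have hy256 : 256 ≤ Nat.sqrt (Nat.sqrt Q) := by
      rw [Nat.le_sqrt', Nat.le_sqrt']
      exact le_trans (by norm_num) (le_trans (Nat.le_add_left _ _) hQT)
    have hrQ : ∀ j, r j ≤ Nat.sqrt Q := fun j => Nat.le_sqrt'.mpr
      (le_trans (Finset.single_le_sum (f := fun j => r j ^ 2) (fun j _ => Nat.zero_le _) (Finset.mem_univ j))
        (le_trans (Nat.le_add_right _ _) hQT))
    have hpr : ∀ j, p ≠ r j := fun j h => by have := hrQ j; omega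
    have hqp : ∀ i, q i ≠ p := fun i h => by have := hqy i; omega
    have hqm : ∀ i, q i % 8 = clsVal (aux.getD i.val (0, 0)).1 := fun i => mod_eight_of_slot h8M (hqκ i) (hκm i)
    have hqr : ∀ i j, q i ≠ r j := fun i j => ne_of_slot_of_dvd (hκu i) (hqκ i) (hr j).one_lt (hrM j)
    have hqe : ∀ i (j : Fin k), jacobiSym (q i : ℤ) (r j) = -1 ↔ (aux.getD i.val (0, 0)).2.testBit j.succ.val = true :=
      fun i j => hκe i (q i) (hq i) (hqκ i) j
    have hq0 : ∀ i, jacobiSym (q i : ℤ) p = -1 ↔ (aux.getD i.val (0, 0)).2.testBit 0 = true := fun i =>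
      sign_iff_of_eq (by rw [hqJ i])
    -- the base primes realise the base datum
    have hbase : Matches (Fin.cons p r : Fin (k + 1) → ℕ) base := by
      refine ⟨fun i => Fin.cases (by simpa using hp) (fun j => by simpa using hr j) i, ?_, ?_, ?_⟩
      · rw [Fin.cons_injective_iff]
        refine ⟨?_, hrinj⟩
        rintro ⟨j, hj⟩; exact hpr j hj.symm
      · intro i
        refine Fin.cases ?_ (fun j => ?_) i
        · simpa using hpm
        · simpa using hrm j
      · intro i j hij
        revert hij
        refine Fin.cases ?_ (fun i' => ?_) i <;> refine Fin.cases ?_ (fun j' => ?_) j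
        · intro hij; exact absurd hij (lt_irrefl _)
        · intro _; simpa using hrp j'
        · intro hij; exact absurd hij (Fin.not_lt_zero _)
        · intro hij; simpa using hrr i' j' (Fin.succ_lt_succ_iff.mp hij)
    -- the realisation (NO mutual-symbol condition)
    have hR : RealisesK base aux (Fin.cons p r) q := by
      refine ⟨hbase, hq, hqm, fun i b => ?_, ?_, fun i b => ?_⟩
      · refine Fin.cases ?_ (fun j => ?_) b
        · simpa using hqp i
        · simpa using hqr i j
      · intro i i' hii'
        by_contra hne
        rcases hdist i i' hne with hcls | ⟨b, hb⟩
        · exact hcls (clsVal_injective ((hqm i).symm.trans (by rw [hii']; exact hqm i')))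
        · apply hb
          revert b
          refine Fin.cases ?_ (fun j => ?_)
          · intro hb
            have a := hq0 i; have a' := hq0 i'
            rw [hii'] at a
            exact Bool.eq_iff_iff.mpr (a.symm.trans a')
          · intro hb
            have a := hqe i j; have a' := hqe i' j
            rw [hii'] at a
            exact Bool.eq_iff_iff.mpr (a.symm.trans a')
      · refine Fin.cases ?_ (fun j => ?_) b
        · simpa using hq0 i
        · simpa using hqe i j
    -- size and the door
    have hysq : Nat.sqrt (Nat.sqrt Q) ^ 2 ≤ Nat.sqrt Q := Nat.sqrt_le' _
    have hprod1 : 1 ≤ ∏ i, q i := Nat.one_le_iff_ne_zero.mpr (Finset.prod_ne_zero_iff.mpr fun i _ => (hq i).ne_zero)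
    have hsize := size_of_le_cube hprod1 (prod_le_cube ht (by omega) q hqy) hy256 (lt_of_le_of_lt hysq hyp)
    have hn : ∏ b, (Fin.cons p r : Fin (k + 1) → ℕ) b = p * ∏ j, r j := by
      rw [Fin.prod_univ_succ]; simp
    haveI : (congruentNumberCurve (2 * (p * ∏ j, r j))).IsElliptic := by
      refine isElliptic_congruentNumberCurve (Nat.mul_ne_zero two_ne_zero (Nat.mul_ne_zero hp.ne_zero
        (Finset.prod_ne_zero_iff.mpr fun j _ => (hr j).ne_zero)))
    have hsize' : Real.sqrt ((∏ i, q i : ℕ) : ℝ) * Real.log ((∏ i, q i : ℕ) : ℝ) <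
        Real.pi * (Fin.cons p r : Fin (k + 1) → ℕ) 0 := by simpa using hsize
    simpa using hR.cruxOn_even_of_BT hBT hpf hn hsize'
  · -- `Q < T`: everything is exceptional
    refine ⟨Finset.range (Q + 1), ?_, fun p _ _ _ _ hpQ hpE => absurd (Finset.mem_range.mpr (by omega)) hpE⟩
    have hQ' : Q < T := not_le.mp hQT
    have h1 : ((Finset.range (Q + 1)).card : ℝ) ≤ (T : ℝ) + 1 := by
      rw [Finset.card_range]; exact_mod_cast (by omega : Q + 1 ≤ T + 1)
    calc ((Finset.range (Q + 1)).card : ℝ) ≤ (T : ℝ) + 1 := h1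
      _ ≤ (∑ i, C i) + ((T : ℝ) + 1) := by linarith
      _ = ((∑ i, C i) + ((T : ℝ) + 1)) * 1 := (mul_one _).symm
      _ ≤ ((∑ i, C i) + ((T : ℝ) + 1)) * Real.log Q ^ 8 :=
          mul_le_mul_of_nonneg_left hlog8 (add_nonneg hCnn (by positivity))

end Summit.BirchSwinnertonDyer.BirchSwinnertonDyer.Theorems.LinnikCensus
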